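import Summits.CriticalPhenomena.PercolationContinuityZ3.Theorems.PercNearOneGluingNoHeavyLowerTailAnchoredExchange
import Summits.CriticalPhenomena.PercolationContinuityZ3.Theorems.PercNearOneGluingNoHeavyLowerTailWeakestPortPeeling
import HarnessLib

/-!
# `NoHeavyLowerTail` (stmt-CriticalPhenomena-4575) — Kozma–Nitzan's gluing lemma for a relay carrying a
# TWO-ATOM UNIT ("all of `P` or nothing"): the MIXED step of the `2+2` kernel

Support file (lemma factory `prim-lf-3` gen 7, seat g9; `--supports stmt-CriticalPhenomena-4575`).  No definitions, no
named facts, no sorries.  Memo: `run/shared/lean/prim/prim-lf-3/LF3-BETA-R.md` §3 (MIXED).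

Setting (`Fin n`, weights `w`, a vertex set `P` with a member `p₁`, a relay `c ∉ P`, a witness `j`, a number `u ∈ [0,1]`).
Write `g := glue_P w` (weight `1` on the non-loop pairs inside `P`) and `g⁺ := g` with the pair `s(c,p₁)` also glued.  Think of
`u` as the probability of a two-atom unit that glues ALL of `P` (and, in the glued world, the observer) or NOTHING: the split
reliability of a vertex `z` is `(1−u)·μ_w(z ↔ b) + u·μ_g(z ↔ b)`.  KN's Lemma 5 says: a witness below `c` stays below the
block obtained by gluing things INTO `c`.  Here the thing glued into `c` is the two-atom unit:

  `twoAtomGlue`:  (1−u)[μ_w(c↔b) − μ_w(j↔b)] + u[μ_g(c↔b) − μ_g(j↔b)] ≥ 0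
                  ⟹ (1−u)[μ_w(c↔b) − μ_w(j↔b)] + u[μ_{g⁺}(c↔b) − μ_{g⁺}(j↔b)] ≥ 0.

Proof (memo §3).  `h₀ := (c−j)_w`, `h₁ := (c−j)_g`, `G₁ := (c−j)_{g⁺}`.  If `h₁ ≥ 0`, `G₁ ≥ 0` by Lemma 5 for the pair
`{c,p₁}` in `g` (`UpsetExchange.hubExchange_union` with the trivial union event); if moreover `h₀ ≥ 0` we are done.
Otherwise (`h₀ < 0` or `h₁ < 0`) we show `G₁ ≥ h₁`: `G₁ − h₁ = gain_c − gain_j` for gluing `c` into the block (`g⁺` is the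
push-forward of `g` under `ω ↦ ω ∪ {s(c,p₁)}`), and `gain_c − gain_j ≥ μ_g(p₁↔b, c↮b, j↮c) − μ_g(c↔b, p₁↮b, j↔p₁) ≥ 0` by the
ANCHORED EXCHANGE `UpsetExchange.anchoredExchange` — with the block `P` and the ranking in `w` when `h₀ < 0`, with the trivial
block `{p₁}` and the ranking in `g` when `h₁ < 0`.
-/

namespace Summit.CriticalPhenomena.PercolationContinuityZ3.Theorems

open MeasureTheory Set ProbabilityTheory
open Literature.Probability.LatticeModels
open Literature.Probability.Percolation

noncomputable section
open Classical

namespace UpsetExchange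

variable {n : ℕ}

/-- **Gluing lemma for a relay with a two-atom unit** (see the module docstring).
[cite: KozmaNitzan2024, Lemma 5 and Lemma 3(i) (pp. 6, 13); VandenbergHaggstromKahn2005, Thm. 1.2] -/
theorem twoAtomGlue (w : Sym2 (Fin n) → unitInterval) (P : Finset (Fin n)) (c j b p₁ : Fin n)
    (hp₁ : p₁ ∈ P) (hcP : c ∉ P) {u : ℝ} (hu0 : 0 ≤ u) (hu1 : u ≤ 1)
    (hyp : 0 ≤ (1 - u) * ((prodBernoulli w).real (openConn c b) - (prodBernoulli w).real (openConn j b)) +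
      u * ((prodBernoulli (fun e : Sym2 (Fin n) => if (∀ x ∈ e, x ∈ P) ∧ ¬ e.IsDiag then 1 else w e)).real (openConn c b) -
        (prodBernoulli (fun e : Sym2 (Fin n) => if (∀ x ∈ e, x ∈ P) ∧ ¬ e.IsDiag then 1 else w e)).real (openConn j b))) :
    0 ≤ (1 - u) * ((prodBernoulli w).real (openConn c b) - (prodBernoulli w).real (openConn j b)) +
      u * ((prodBernoulli (fun f : Sym2 (Fin n) => if f = s(c, p₁) then 1 else
              (if (∀ x ∈ f, x ∈ P) ∧ ¬ f.IsDiag then 1 else w f))).real (openConn c b) -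
        (prodBernoulli (fun f : Sym2 (Fin n) => if f = s(c, p₁) then 1 else
              (if (∀ x ∈ f, x ∈ P) ∧ ¬ f.IsDiag then 1 else w f))).real (openConn j b)) := by
  classical
  set g : Sym2 (Fin n) → unitInterval := fun e => if (∀ x ∈ e, x ∈ P) ∧ ¬ e.IsDiag then 1 else w e with hg
  set e : Sym2 (Fin n) := s(c, p₁) with he
  set gp : Sym2 (Fin n) → unitInterval := fun f => if f = e then 1 else g f with hgp
  have hcp : c ≠ p₁ := fun h => hcP (h ▸ hp₁)
  set h0 : ℝ := (prodBernoulli w).real (openConn c b) - (prodBernoulli w).real (openConn j b) with hh0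
  set h1 : ℝ := (prodBernoulli g).real (openConn c b) - (prodBernoulli g).real (openConn j b) with hh1
  set G1 : ℝ := (prodBernoulli gp).real (openConn c b) - (prodBernoulli gp).real (openConn j b) with hG1
  -- (1) `gp` is the push-forward of `g` under `ω ↦ ω ∪ {e}`
  have hpush : ∀ X : Set (BondConfig (Fin n)), (prodBernoulli gp).real X =
      (prodBernoulli g).real {ω | ((ω ∪ {e} : Set (Sym2 (Fin n))) : BondConfig (Fin n)) ∈ X} := by
    intro X
    exact glueSet_pushforward g gp {e} (fun f hf => by rw [mem_singleton_iff.1 hf]; simp [hgp])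
      (fun f hf => by
        have hf' : f ≠ e := fun h => hf (h ▸ mem_singleton _)
        simp [hgp, hf']) X
  have hcb : {ω : BondConfig (Fin n) | ((ω ∪ {e} : Set (Sym2 (Fin n))) : BondConfig (Fin n)) ∈ (openConn c b : Set _)} =
      openConn c b ∪ openConn p₁ b := by
    ext ω
    simp only [mem_setOf_eq, mem_union]
    constructor
    · intro h
      rcases WeakestPort.reachable_union_pair (x := c) (y := p₁) (h : (openGraph _).Reachable c b) with h1 | ⟨-, h3⟩ | ⟨-, h3⟩
      · exact Or.inl h1
      · exact Or.inr h3
      · exact Or.inl h3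
    · rintro (h | h)
      · exact WeakestPort.reachable_union_pair_of hcp (Or.inl h)
      · exact WeakestPort.reachable_union_pair_of hcp (Or.inr (Or.inl ⟨SimpleGraph.Reachable.refl _, h⟩))
  have hjb : {ω : BondConfig (Fin n) | ((ω ∪ {e} : Set (Sym2 (Fin n))) : BondConfig (Fin n)) ∈ (openConn j b : Set _)} =
      openConn j b ∪ (openConn j c ∩ openConn p₁ b) ∪ (openConn j p₁ ∩ openConn c b) := by
    ext ω
    simp only [mem_setOf_eq, mem_union, mem_inter_iff]
    constructor
    · intro h
      rcases WeakestPort.reachable_union_pair (x := c) (y := p₁) (h : (openGraph _).Reachable j b) with h1 | ⟨h2, h3⟩ | ⟨h2, h3⟩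
      · exact Or.inl (Or.inl h1)
      · exact Or.inl (Or.inr ⟨h2, h3⟩)
      · exact Or.inr ⟨h2, h3⟩
    · rintro ((h | ⟨h2, h3⟩) | ⟨h2, h3⟩)
      · exact WeakestPort.reachable_union_pair_of hcp (Or.inl h)
      · exact WeakestPort.reachable_union_pair_of hcp (Or.inr (Or.inl ⟨h2, h3⟩))
      · exact WeakestPort.reachable_union_pair_of hcp (Or.inr (Or.inr ⟨h2, h3⟩))
  have eC : (prodBernoulli gp).real (openConn c b) = (prodBernoulli g).real (openConn c b ∪ openConn p₁ b) := by
    rw [hpush, hcb]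
  have eJ : (prodBernoulli gp).real (openConn j b) =
      (prodBernoulli g).real (openConn j b ∪ (openConn j c ∩ openConn p₁ b) ∪ (openConn j p₁ ∩ openConn c b)) := by
    rw [hpush, hjb]
  -- (2) gain bookkeeping: `G1 − h1 ≥ μ_g(p₁↔b, c↮b, j↮c) − μ_g(c↔b, p₁↮b, j↔p₁)`
  have hgainc : (prodBernoulli g).real (openConn c b ∪ openConn p₁ b) - (prodBernoulli g).real (openConn c b) =
      (prodBernoulli g).real (openConn p₁ b ∩ (openConn c b)ᶜ) := by
    have := measureReal_union_add_inter (μ := prodBernoulli g) (s := openConn p₁ b)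
      (MeasurableSet.of_discrete : MeasurableSet (openConn c b : Set (BondConfig (Fin n))))
    have h2 := measureReal_inter_add_sdiff (μ := prodBernoulli g) (s := openConn p₁ b)
      (MeasurableSet.of_discrete : MeasurableSet (openConn c b : Set (BondConfig (Fin n)))) (measure_ne_top _ _)
    have h3 : (openConn p₁ b : Set (BondConfig (Fin n))) \ openConn c b = openConn p₁ b ∩ (openConn c b)ᶜ := by
      ext ω; simp [mem_sdiff]
    rw [union_comm] at this
    rw [h3] at h2
    linarith
  have hgainj : (prodBernoulli g).real (openConn j b ∪ (openConn j c ∩ openConn p₁ b) ∪ (openConn j p₁ ∩ openConn c b)) -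
      (prodBernoulli g).real (openConn j b) ≤
      (prodBernoulli g).real ((openConn j c ∩ openConn p₁ b) ∩ (openConn j b)ᶜ) +
        (prodBernoulli g).real ((openConn j p₁ ∩ openConn c b) ∩ (openConn j b)ᶜ) := by
    have hsub : (openConn j b ∪ (openConn j c ∩ openConn p₁ b) ∪ (openConn j p₁ ∩ openConn c b) : Set (BondConfig (Fin n))) ⊆
        openConn j b ∪ (((openConn j c ∩ openConn p₁ b) ∩ (openConn j b)ᶜ) ∪ ((openConn j p₁ ∩ openConn c b) ∩ (openConn j b)ᶜ)) := by
      intro ω hω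
      by_cases h : ω ∈ (openConn j b : Set (BondConfig (Fin n)))
      · exact Or.inl h
      · rcases hω with (h1' | h2') | h3'
        · exact Or.inl h1'
        · exact Or.inr (Or.inl ⟨h2', h⟩)
        · exact Or.inr (Or.inr ⟨h3', h⟩)
    have m1 := measureReal_mono hsub (measure_ne_top (prodBernoulli g) _)
    have m2 := measureReal_union_le (μ := prodBernoulli g) (openConn j b : Set (BondConfig (Fin n)))
      (((openConn j c ∩ openConn p₁ b) ∩ (openConn j b)ᶜ) ∪ ((openConn j p₁ ∩ openConn c b) ∩ (openConn j b)ᶜ))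
    have m3 := measureReal_union_le (μ := prodBernoulli g) ((openConn j c ∩ openConn p₁ b) ∩ (openConn j b)ᶜ : Set (BondConfig (Fin n)))
      ((openConn j p₁ ∩ openConn c b) ∩ (openConn j b)ᶜ)
    linarith
  have hE1 : (prodBernoulli g).real (openConn p₁ b ∩ (openConn c b)ᶜ) -
      (prodBernoulli g).real ((openConn j c ∩ openConn p₁ b) ∩ (openConn j b)ᶜ) =
      (prodBernoulli g).real (openConn p₁ b ∩ (openConn c b)ᶜ ∩ (openConn j c)ᶜ) := by
    have h2 := measureReal_inter_add_sdiff (μ := prodBernoulli g) (s := openConn p₁ b ∩ (openConn c b)ᶜ)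
      (MeasurableSet.of_discrete : MeasurableSet (openConn j c : Set (BondConfig (Fin n)))) (measure_ne_top _ _)
    have hA : (openConn p₁ b ∩ (openConn c b)ᶜ : Set (BondConfig (Fin n))) ∩ openConn j c =
        (openConn j c ∩ openConn p₁ b) ∩ (openConn j b)ᶜ := by
      ext ω
      simp only [mem_inter_iff, mem_compl_iff]
      constructor
      · rintro ⟨⟨hpb, hncb⟩, hjc⟩
        refine ⟨⟨hjc, hpb⟩, fun hjb' => hncb ?_⟩
        exact (hjc : (openGraph ω).Reachable j c).symm.trans hjb'
      · rintro ⟨⟨hjc, hpb⟩, hnjb⟩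
        refine ⟨⟨hpb, fun hcb' => hnjb ?_⟩, hjc⟩
        exact (hjc : (openGraph ω).Reachable j c).trans hcb'
    have hB : (openConn p₁ b ∩ (openConn c b)ᶜ : Set (BondConfig (Fin n))) \ openConn j c =
        openConn p₁ b ∩ (openConn c b)ᶜ ∩ (openConn j c)ᶜ := by
      ext ω; simp [mem_sdiff, mem_inter_iff]
    rw [hA, hB] at h2
    linarith
  have hE2 : (prodBernoulli g).real ((openConn j p₁ ∩ openConn c b) ∩ (openConn j b)ᶜ) =
      (prodBernoulli g).real (openConn c b ∩ (openConn p₁ b)ᶜ ∩ openConn j p₁) := by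
    congr 1
    ext ω
    simp only [mem_inter_iff, mem_compl_iff]
    constructor
    · rintro ⟨⟨hjp, hcb'⟩, hnjb⟩
      refine ⟨⟨hcb', fun hpb => hnjb ?_⟩, hjp⟩
      exact (hjp : (openGraph ω).Reachable j p₁).trans hpb
    · rintro ⟨⟨hcb', hnpb⟩, hjp⟩
      refine ⟨⟨hjp, hcb'⟩, fun hjb' => hnpb ?_⟩
      exact (hjp : (openGraph ω).Reachable j p₁).symm.trans hjb'
  have hgain : (prodBernoulli g).real (openConn c b ∩ (openConn p₁ b)ᶜ ∩ openConn j p₁) ≤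
      (prodBernoulli g).real (openConn p₁ b ∩ (openConn c b)ᶜ ∩ (openConn j c)ᶜ) → h1 ≤ G1 := by
    intro hX
    have : G1 - h1 = ((prodBernoulli g).real (openConn c b ∪ openConn p₁ b) - (prodBernoulli g).real (openConn c b)) -
        ((prodBernoulli g).real (openConn j b ∪ (openConn j c ∩ openConn p₁ b) ∪ (openConn j p₁ ∩ openConn c b)) -
          (prodBernoulli g).real (openConn j b)) := by
      rw [hG1, hh1, eC, eJ]; ring
    linarith [this, hgainc, hgainj, hE1, hE2, hX]
  -- (3) Lemma 5 for the pair `{c, p₁}` in `g`: `h1 ≥ 0 ⟹ G1 ≥ 0`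
  have hL5 : 0 ≤ h1 → 0 ≤ G1 := by
    intro hh
    have hle : (prodBernoulli g).real (openConn j b) ≤ (prodBernoulli g).real (openConn c b) := by linarith [hh, hh1]
    have hglue : (fun f : Sym2 (Fin n) => if (∀ x ∈ f, x ∈ ({c, p₁} : Finset (Fin n))) ∧ ¬ f.IsDiag then (1 : unitInterval)
        else g f) = gp := by
      funext f
      by_cases hf : f = e
      · rw [hf]
        have key : (∀ x ∈ e, x ∈ ({c, p₁} : Finset (Fin n))) ∧ ¬ e.IsDiag := by
          rw [he]
          refine ⟨fun x hx => ?_, by rw [Sym2.mk_isDiag_iff]; exact hcp⟩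
          rcases Sym2.mem_iff.1 hx with rfl | rfl <;> simp
        rw [if_pos key]
        simp [hgp]
      · have hnot : ¬ ((∀ x ∈ f, x ∈ ({c, p₁} : Finset (Fin n))) ∧ ¬ f.IsDiag) := by
          rintro ⟨h1', h2'⟩
          apply hf
          induction f using Sym2.ind with
          | h x y =>
            have hx := h1' x (Sym2.mem_mk_left x y)
            have hy := h1' y (Sym2.mem_mk_right x y)
            rw [Finset.mem_insert, Finset.mem_singleton] at hx hy
            rw [Sym2.mk_isDiag_iff] at h2'
            rw [he, Sym2.eq_iff]
            rcases hx with rfl | rfl <;> rcases hy with rfl | rfl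
            · exact absurd rfl h2'
            · exact Or.inl ⟨rfl, rfl⟩
            · exact Or.inr ⟨rfl, rfl⟩
            · exact absurd rfl h2'
        simp only [if_neg hnot, hgp, if_neg hf]
    -- Lemma 5 for the pair = `hubExchange_union` with the family `{∅}` (union event = `univ`)
    have hx' := hubExchange_union g ({c, p₁} : Finset (Fin n)) j b c (by simp) ({∅} : Finset (Finset (Sym2 (Fin n))))
      (by simp) hle
    have hU : {ω : BondConfig (Fin n) | ∃ C ∈ ({∅} : Finset (Finset (Sym2 (Fin n)))), (↑C : Set (Sym2 (Fin n))) ⊆ ω} = univ := by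
      ext ω; simp
    rw [hglue, hU, inter_univ, inter_univ] at hx'
    linarith [hx', hG1]
  -- (4) the anchored exchange in the two remaining cases
  have hAw : h0 < 0 → h1 ≤ G1 := by
    intro hh
    have hle : (prodBernoulli w).real (openConn c b) ≤ (prodBernoulli w).real (openConn j b) := by linarith [hh, hh0]
    exact hgain (anchoredExchange w P c j b p₁ hp₁ hle)
  have hAg : h1 < 0 → h1 ≤ G1 := by
    intro hh
    have hle : (prodBernoulli g).real (openConn c b) ≤ (prodBernoulli g).real (openConn j b) := by linarith [hh, hh1]
    have hx := anchoredExchange g ({p₁} : Finset (Fin n)) c j b p₁ (Finset.mem_singleton_self _) hle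
    have hglue : (fun f : Sym2 (Fin n) => if (∀ x ∈ f, x ∈ ({p₁} : Finset (Fin n))) ∧ ¬ f.IsDiag then (1 : unitInterval)
        else g f) = g := by
      funext f
      by_cases hf : (∀ x ∈ f, x ∈ ({p₁} : Finset (Fin n))) ∧ ¬ f.IsDiag
      · exfalso
        obtain ⟨h1', h2'⟩ := hf
        induction f using Sym2.ind with
        | h x y =>
          have hx := Finset.mem_singleton.1 (h1' x (Sym2.mem_mk_left x y))
          have hy := Finset.mem_singleton.1 (h1' y (Sym2.mem_mk_right x y))
          exact h2' (by rw [Sym2.mk_isDiag_iff, hx, hy])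
      · simp only [if_neg hf]
    rw [hglue] at hx
    exact hgain hx
  -- (5) conclusion
  change 0 ≤ (1 - u) * h0 + u * G1
  have hyp' : 0 ≤ (1 - u) * h0 + u * h1 := hyp
  by_cases hc1 : 0 ≤ h1
  · by_cases hc0 : 0 ≤ h0
    · have := hL5 hc1
      positivity
    · have := hAw (lt_of_not_ge hc0)
      nlinarith
  · have := hAg (lt_of_not_ge hc1)
    nlinarith

end UpsetExchange

end

end Summit.CriticalPhenomena.PercolationContinuityZ3.Theorems
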